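import Literature.MathematicalPhysics.QuantumFieldTheory.Balaban1983to89.B15Prop1JointHolomorphyFromBackground
import Literature.MathematicalPhysics.QuantumFieldTheory.Balaban1983to89.B15Prop1ValueOfAnyMinimiser

/-!
# `Balaban1983to89.B15Prop1JointHolomorphyFromMinimiserFamily` — [Balaban1989LargeFieldI] = «[IV]», Prop. 1 p. 194 (last clause), (1.74) p. 192, (1.77) p. 194;
# [Balaban1989LargeFieldII] = «[LF-II]», p. 359; [Balaban1985Variational] = «[15]», Prop. 9 (190) p. 309; [Balaban1988Convergent] = «[III]», (2.12) p. 256: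
# (J1) ⇐ (J0′) — THE JOINT HOLOMORPHIC EXTENSION OF PRINT'S FUNCTION (1.77) FROM A HOLOMORPHIC FAMILY OF (2.12) MINIMISERS, and ★★★ PROPOSITION 1 [IV] AT PRINT'S
# (1.74) OBJECT WITH THE INTRINSIC CONFIGURATION LETTER (J0′)

Honest framing: statement-level skeleton of published theorems with citation tags; proofs where landed; nothing here is a claim about the
Yang–Mills mass gap.  Cell `pub-ymgap`, HUMAN RULING D-0149 (width seats), seat `pub-ymgap-dag-n12-w1` (N12 = [B15]; W-SEAT-START-LIST §N12 item 1 = U1a);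
count-neutral; N12 NOT discharged; finite 𝕋⁴ at fixed ε; nothing continuum ∕ OS ∕ mass-gap ∕ Clay.

WHY.  [15] Prop. 9 p. 309, verbatim: *«The minimal configuration U_k(V) … has an extension to an analytic function of Gᶜ-valued small configurations V′»*;
[LF-II] p. 359: *«The above equations, bounds and statements are valid for 𝔤ᶜ-valued fields, hence the existence of the analytic extension follows
immediately»*.  The N12∕s1 endpoints for Proposition 1 [IV] (dag-n12-c: `B15Prop1Thm1GeneralFormShapes` §4, p556967) read the action-level letter (J1) `hGj`;
dag-n12-c's `B15Prop1JointHolomorphyFromBackground` (p583244) derives (J1) from the VALUE-MATCHED configuration letter (J0ᵛ) («a holomorphic bounded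
M₂(ℂ)-family which at every real point IS some SU(2) configuration carrying the value (1.77)»), re-shaped from the selector-pinned (J0) after this seat's
LOCATED-SELECTOR (NODE 00's `bgKZstd … = UminOfRecord …` is an opaque `Classical.choose` selection from the (2.12) minimal ORBIT, [III] p. 256, so no letter
may pin a holomorphic family to its values).  THIS MODULE closes the triangle with the INTRINSIC letter (J0′) = exactly print's (190) object: «a holomorphic
bounded M₂(ℂ)-family on the sup-ball which at every real point IS SOME (2.12) MINIMISER (`IsMinimizer`) of the datum of the chart configuration» — (J0′) ⇒ (J0ᵛ)
by this seat's value-of-any-minimiser junction (`B15Prop1ValueOfAnyMinimiser`: (1.77) is the VALUE function, two minimisers of one problem have one action,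
the solvable-set domain of `Node00.bgOfRecord` is inhabited by the minimiser itself), hence (J1), hence Proposition 1 [IV] at print's (1.74) object with
(J0′) in place of (J1) — every other binder verbatim as in p556967 ∕ p583244.

CONTENTS (theorems only; no `def`, no `instance`, no `sorry`).
* §1 ★ `jointHolomorphic_fun177std_bgOfRecord_of_minimiserFamily` — (J1) ⇐ (J0′) at NODE 00's totalised solution map `Node00.bgOfRecord av reg`, any class `reg`,
  any `SU(2)` averaging (one application of dag-n12-c's `jointHolomorphic_fun177std_of_valueMatched` after the junction).
* §2 ★★ `jointHolomorphic_fun177std_bgMSCoPOfRecord_of_minimiserFamily` — the same at NODE 00's (2.12) datum of record `Node00.bgMSCoPOfRecord F 2 ν K k Ω`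
  (the class `regMSCoPOfRecord` on the support of record), the form the endpoints read.
* §3 ★★★ `exists_domain_prop1Printed_lfVarOn_std_su2_box_intrinsic_analytic_atZSeqCoPRecord_ofThm1TorusClass_ofMinimiserFamily` — p583244 §4 VERBATIM with
  (J0ᵛ) `hBg` REPLACED by (J0′) `hMin`.
LETTERS after this module (per instance): (J0′) `hMin` — [15] Thm 1 (existence of minimisers along the real ball) + Prop. 9 (190) (a holomorphic selection) at
NODE 00's objects, whose generic finite-dimensional mechanism is `Literature.Analysis.Calculus.ConstrainedCriticalFamily` (this seat) —, (L2) `hlead`+`hsm`∕`hγle`,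
`hfar`, (Gᵃ) `hZblk`, bookkeeping; once per run `h15T` (served by K0⁷'s def, dag-n12-d 12Q⁵).
-/

noncomputable section

open Set Metric
namespace Literature.MathematicalPhysics.QuantumFieldTheory.Balaban1983to89.B15Prop1JointHolomorphyFromMinimiserFamily

open T4Continuum B15DeterminingSets GaugeField B15Prop1Carrier B8Eq17ClassAkV1 BlockAveraging
open B14.Eq22Determines (blockIter IsBlockUnion)
open Literature.MathematicalPhysics.QuantumFieldTheory.BalabanImbrieJaffe1984to88.BIJ85Eq453GaugeField (qsstarGIter0)
open B15Prop1DatumSmall7AtZSequence B15Prop1Thm1GeneralFormAtZSequence B15Prop1Thm1GeneralFormShapes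
open B15Prop1JointHolomorphyFromBackground B15Prop1ValueOfAnyMinimiser
open T4CubeChartGnomonic (SU2)
open scoped BigOperators

/-! ## §1  (J1) ⇐ (J0′) at NODE 00's totalised solution map `Node00.bgOfRecord av reg` -/

section OfRecord
open B14.Eq213DetSet B15Sect1Instances B16Sect1Backgrounds
open B15Prop1AnalyticExtClause (cplxVec)
open B15Prop1ChartCalculusSU2 (E3)
open B15Prop1ChartSU2 (su2Chart)

variable {P : Params}

/-- ★ **(J1) FROM A HOLOMORPHIC FAMILY OF MINIMISERS, at NODE 00's totalised (2.12) solution map** `bg := Node00.bgOfRecord av reg` (any class `reg`):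
if on the sup-ball of radius `R` there is ONE family `Ũ` of bond matrices with ℂ-differentiable entries bounded by `𝓐₀` which at every REAL point
`(p, B′)` IS some `SU(2)` configuration `U′` that is a MINIMAL CONFIGURATION of the (2.12) problem for the datum `M˙(Q_k^{s*}(exp(iB′)·ext(exp(ip)V_k)))` on
`𝐁_k(Z)` in the class `reg` — print's object `U_k(V′)` of [15] Prop. 9 (190) along the chart — then print's function (1.77) `A(U_{k,Z}(·))` along the chart
is the real trace of ONE ℂ-differentiable `𝒢` on that ball, `‖𝒢‖ ≤ |Plaq|·(1 + 8𝓐₀⁴)`: the letter (J1).  One line: the minimiser carries the VALUE (1.77)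
(`fun177std_bgOfRecord_eq_wilsonAction4_of_isMinimizer`), then dag-n12-c's `jointHolomorphic_fun177std_of_valueMatched`.
[cite: Balaban1989LargeFieldI, (1.74) p.192, (1.77) and Prop. 1 p.194; Balaban1989LargeFieldII, p.359; Balaban1985Variational, Prop. 9 (190) p.309; Balaban1988Convergent, (2.12) p.256] -/
theorem jointHolomorphic_fun177std_bgOfRecord_of_minimiserFamily (av : ∀ j, Averaging P j SU2) (reg : Set (GaugeField P 0 SU2))
    (M₁ : ℕ) (Z : Set (Site P 0)) (k : ℕ) (ext : GaugeField P k SU2 → GaugeField P k SU2) (Vk : GaugeField P k SU2) {R 𝓐₀ : ℝ}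
    (hMin : ∃ Ũ : VecField P k (EuclideanSpace ℂ (Fin 3)) × VecField P k (EuclideanSpace ℂ (Fin 3)) → PBond P 0 → Matrix (Fin 2) (Fin 2) ℂ,
      (∀ b a c, DifferentiableOn ℂ (fun z => Ũ z b a c) (ball 0 R)) ∧
      (∀ z ∈ ball (0 : VecField P k (EuclideanSpace ℂ (Fin 3)) × VecField P k (EuclideanSpace ℂ (Fin 3))) R, ∀ b a c, ‖Ũ z b a c‖ ≤ 𝓐₀) ∧
      ∀ p B' : VecField P k E3, ‖p‖ < R → ‖B'‖ < R → ∃ U' : GaugeField P 0 SU2,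
        (∀ b, Ũ (cplxVec p, cplxVec B') b = ((U' b : SU2) : Matrix (Fin 2) (Fin 2) ℂ)) ∧
          IsMinimizer av reg (Bj M₁ Z k) (avgFamily av (qsstarGIter0 k (expMul su2Chart B' (ext (expMul su2Chart p Vk))))) U') :
    ∃ 𝒢 : VecField P k (EuclideanSpace ℂ (Fin 3)) × VecField P k (EuclideanSpace ℂ (Fin 3)) → ℂ,
      DifferentiableOn ℂ 𝒢 (ball 0 R) ∧
      (∀ z ∈ ball (0 : VecField P k (EuclideanSpace ℂ (Fin 3)) × VecField P k (EuclideanSpace ℂ (Fin 3))) R,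
        ‖𝒢 z‖ ≤ (Fintype.card (Plaq P 0) : ℝ) * (1 + 8 * 𝓐₀ ^ 4)) ∧
      ∀ p B' : VecField P k E3, ‖p‖ < R → ‖B'‖ < R →
        𝒢 (cplxVec p, cplxVec B') = ((fun177std (Node00.bgOfRecord av reg) M₁ Z k (expMul su2Chart B' (ext (expMul su2Chart p Vk))) : ℝ) : ℂ) := by
  obtain ⟨Ũ, hdiff, hbd, hreal⟩ := hMin
  refine jointHolomorphic_fun177std_of_valueMatched (Node00.bgOfRecord av reg) M₁ Z k ext Vk ⟨Ũ, hdiff, hbd, fun p B' hp hB' => ?_⟩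
  obtain ⟨U', hU', hmin⟩ := hreal p B' hp hB'
  exact ⟨U', hU', (fun177std_bgOfRecord_eq_wilsonAction4_of_isMinimizer av reg M₁ Z k hmin).symm⟩

end OfRecord

/-! ## §2  (J1) ⇐ (J0′) at NODE 00's (2.12) datum of record `Node00.bgMSCoPOfRecord F 2 ν K k Ω` -/

section Record
open B14.Eq213DetSet B15Sect1Instances B16Sect1Backgrounds
open B15Prop1AnalyticExtClause (cplxVec)
open B15Prop1ChartCalculusSU2 (E3)
open B15Prop1ChartSU2 (su2Chart)

variable {F : T4Family}

/-- ★★ **(J1) FROM A HOLOMORPHIC FAMILY OF MINIMISERS, at NODE 00's (2.12) datum of record** `Node00.bgMSCoPOfRecord F 2 ν K k Ω` (the class `regMSCoPOfRecord F 2 ν K k Ω`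
= [15] (2) on the support of record): the form in which the N12 endpoints read the letter.  A holomorphic bounded bond-matrix family on the sup-ball which at every
real point of the chart family is SOME minimal configuration of the (2.12) problem of that point's datum ⇒ (J1) for `fun177std (bgMSCoPOfRecord …)`.
[cite: Balaban1989LargeFieldI, (1.74) p.192, (1.77) and Prop. 1 p.194; Balaban1989LargeFieldII, p.359; Balaban1985Variational, (2) p.278, Prop. 9 (190) p.309; Balaban1988Convergent, (2.12) p.256, p.255] -/
theorem jointHolomorphic_fun177std_bgMSCoPOfRecord_of_minimiserFamily (ν : Node00.Stage7Numerics) (K k : ℕ) (Ω : ℕ → Set (Site (F.P K) 0))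
    (M₁ : ℕ) (Z : Set (Site (F.P K) 0)) (k' : ℕ) (ext : GaugeField (F.P K) k' SU2 → GaugeField (F.P K) k' SU2)
    (Vk : GaugeField (F.P K) k' SU2) {R 𝓐₀ : ℝ}
    (hMin : ∃ Ũ : VecField (F.P K) k' (EuclideanSpace ℂ (Fin 3)) × VecField (F.P K) k' (EuclideanSpace ℂ (Fin 3)) →
        PBond (F.P K) 0 → Matrix (Fin 2) (Fin 2) ℂ,
      (∀ b a c, DifferentiableOn ℂ (fun z => Ũ z b a c) (ball 0 R)) ∧
      (∀ z ∈ ball (0 : VecField (F.P K) k' (EuclideanSpace ℂ (Fin 3)) × VecField (F.P K) k' (EuclideanSpace ℂ (Fin 3))) R,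
        ∀ b a c, ‖Ũ z b a c‖ ≤ 𝓐₀) ∧
      ∀ p B' : VecField (F.P K) k' E3, ‖p‖ < R → ‖B'‖ < R → ∃ U' : GaugeField (F.P K) 0 SU2,
        (∀ b, Ũ (cplxVec p, cplxVec B') b = ((U' b : SU2) : Matrix (Fin 2) (Fin 2) ℂ)) ∧
          IsMinimizer (Node00.avOfRecord F 2 K) (Node00.regMSCoPOfRecord F 2 ν K k Ω) (Bj M₁ Z k')
            (avgFamily (Node00.avOfRecord F 2 K) (qsstarGIter0 k' (expMul su2Chart B' (ext (expMul su2Chart p Vk))))) U') :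
    ∃ 𝒢 : VecField (F.P K) k' (EuclideanSpace ℂ (Fin 3)) × VecField (F.P K) k' (EuclideanSpace ℂ (Fin 3)) → ℂ,
      DifferentiableOn ℂ 𝒢 (ball 0 R) ∧
      (∀ z ∈ ball (0 : VecField (F.P K) k' (EuclideanSpace ℂ (Fin 3)) × VecField (F.P K) k' (EuclideanSpace ℂ (Fin 3))) R,
        ‖𝒢 z‖ ≤ (Fintype.card (Plaq (F.P K) 0) : ℝ) * (1 + 8 * 𝓐₀ ^ 4)) ∧
      ∀ p B' : VecField (F.P K) k' E3, ‖p‖ < R → ‖B'‖ < R →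
        𝒢 (cplxVec p, cplxVec B') =
          ((fun177std (Node00.bgMSCoPOfRecord F 2 ν K k Ω) M₁ Z k' (expMul su2Chart B' (ext (expMul su2Chart p Vk))) : ℝ) : ℂ) :=
  jointHolomorphic_fun177std_bgOfRecord_of_minimiserFamily (Node00.avOfRecord F 2 K) (Node00.regMSCoPOfRecord F 2 ν K k Ω) M₁ Z k' ext Vk hMin

end Record

/-! ## §3  Proposition 1 [IV] at print's (1.74) object with the INTRINSIC configuration letter (J0′) in place of (J1) -/

section Endpoint

open Classical
open scoped RealInnerProductSpace InnerProductSpace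
open B14DomainGeom (IsUnionOfCubes)
open B15Eq112TorusCover (cover)
open B14.Eq213MaximalDomains (side)
open B14.Eq213DetSet B15Sect1Instances B16Sect1Wilson B16Sect1Backgrounds B15Prop1GradientFromNearValue B15Prop1GradientFromNearValueAtCoPRecord
open B15Prop1AtZSequenceRecord B15Prop1SliceTaylorCalculus B15Prop1IntrinsicOfFun
open B15Prop1AnalyticExtClause (cplxVec cplxSlice anExt)
open B15Prop1ChartCalculusSU2 (E3)
open B15Prop1ChartSU2 (su2Chart)
open B15Prop1SliceCoordinates (GaugeSlice ιA freeBonds)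
open T4AxialGaugeSmallField (castSite boxPlaqs)
open B6BondElimination (unitVec)
open B16Eq18Proof (box)
open B15Extension193 (extend)
open B15ShellGauge193 (shellGauge)
open B5Bounds167Lattice (formDk ofRealCfg)
open T4Continuum

/-- ★★★ **PROPOSITION 1 [IV] AT PRINT'S (1.74) OBJECT, THE ANALYTIC INPUT AS A HOLOMORPHIC FAMILY OF (2.12) MINIMISERS** — dag-n12-c's
`B15Prop1JointHolomorphyFromBackground.exists_domain_prop1Printed_lfVarOn_std_su2_box_intrinsic_analytic_atZSeqCoPRecord_ofThm1TorusClass_ofValueMatched` (p583244)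
VERBATIM but for the configuration letter: (J0ᵛ) `hBg` (value-matched family) is REPLACED by the INTRINSIC (J0′) `hMin` — ONE family of bond matrices with
ℂ-differentiable entries bounded by `𝓐₀ i` on the sup-ball `R i` which at every real point `(p, B′)` IS SOME MINIMAL CONFIGURATION (`IsMinimizer`) of the (2.12)
problem for the datum `M˙(Q_k^{s*}(exp(iB′)·ext(exp(ip)V_k)))` on `𝐁_k(Z)` in NODE 00's class of record `regMSCoPOfRecord F 2 ν Kt k (maxDomT ν.M₁ Z)` — print's
`U_k(V′)` of [Balaban1985Variational] Prop. 9 p. 309 «has an extension to an analytic function of Gᶜ-valued small configurations V′» read along the chart, a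
statement about the minimal SET of (2.12) ([Balaban1988Convergent] p. 256 «the minimal orbit, i.e., the set of minima») and not about NODE 00's selector.
The reduction is §2 ((1.77) is the value function).  Every other binder and the conclusion as in p583244 ∕ p556967.
[cite: Balaban1989LargeFieldI, (1.74) p.192, Prop. 1 (1.77)–(1.78) p.194 (incl. the last clause), p.193, (1.79) p.195; Balaban1989LargeFieldII, (1.7)–(1.9)
p.358, (1.12)–(1.13) p.359; Balaban1985Variational, (1) p.277, (2) p.278, Thm 1 (8) p.279, Prop. 9 (190) p.309; Balaban1988Convergent, (2.12)–(2.14) pp.256–257,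
(2.16)–(2.18) p.257] -/
theorem exists_domain_prop1Printed_lfVarOn_std_su2_box_intrinsic_analytic_atZSeqCoPRecord_ofThm1TorusClass_ofMinimiserFamily {F : T4Family}
    (ν : Node00.Stage7Numerics) (Kt : ℕ) (hd3 : 3 ≤ (F.P Kt).d) (h0 : 0 < (F.P Kt).d) {ι : Type}
    [hdec : ∀ j, DecidableEq (PBond (F.P Kt) j)] (hcl : hdec = fun _ a b => Classical.propDecidable (a = b))
    (Z Λ : ι → Set (Site (F.P Kt) 0)) (k : ι → ℕ) (M : ι → ℝ) (hk0 : ∀ i, 0 < k i) (hk : ∀ i, k i ≤ (F.P Kt).m + (F.P Kt).K)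
    (eR : ι → ℝ) (heR : ∀ i, 0 < eR i)
    (T : ∀ i, Finset (PBond (F.P Kt) (k i)))
    (lo hi : ι → Fin (F.P Kt).d → ℤ) (n : ι → ℕ) (hn : ∀ i κ, hi i κ ≤ lo i κ + n i) (hN : ∀ i, n i + 2 < (F.P Kt).sitesPerDir (k i))
    (hbox : ∀ i, pts (k i) (Λ i) = (castSite '' Set.Icc (lo i) (hi i) : Set (Site (F.P Kt) (k i))))
    (hZ : ∀ i, (boxPlaqs (lo i - 1) (hi i + 1) : Set (Plaq (F.P Kt) (k i))) ⊆ plaqsInside (pts (k i) (Z i)))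
    (hTG0 : ∀ i, T i = (box (fun κ => (hi i κ - lo i κ + 1).toNat) (lo i)).image fun x =>
      (⟨castSite (x - unitVec ⟨0, h0⟩), ⟨0, h0⟩⟩ : PBond (F.P Kt) (k i)))
    (hN5 : ∀ i κ, ((hi i κ - lo i κ + 1).toNat : ℤ) + 5 < (F.P Kt).sitesPerDir (k i))
    (K : ι → ℕ) (hK1 : ∀ i, 1 ≤ K i) (hKn : ∀ i κ, (hi i κ - lo i κ + 1).toNat ≤ K i)
    (ext : ∀ i, GaugeField (F.P Kt) (k i) SU2 → GaugeField (F.P Kt) (k i) SU2)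
    (hext : ∀ i Vk, ext i Vk = extend (pts (k i) (Λ i)) (shellGauge Vk (lo i) (hi i)) Vk)
    (hlohi : ∀ i, lo i ≤ hi i)
    {γ cJ bx : ℝ} (hγ : 0 < γ) (hcJ : 0 ≤ cJ) (hbx : 0 ≤ bx)
    (hbxM : ∀ i, 12 * ((F.P Kt).d : ℝ) * ((n i : ℝ) + 2) ^ 2 ≤ bx * (M i) ^ 2)
    {Cerr R 𝓐₀ : ι → ℝ} (hM : ∀ i, 1 ≤ (M i)) (hR : ∀ i, 0 < R i)
    (n' : ι → ℕ) (hn' : ∀ i, 1 ≤ n' i)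
    -- (J0′) ONE family along the chart family with ℂ-differentiable bounded matrix entries which at every real point IS SOME (2.12) MINIMISER of that
    -- point's datum in the class of record — print's object `U_k(V′)` of [15] Prop. 9 (190); intrinsic (not pinned to the selector `UminOfRecord`)
    (hMin : ∀ i Vk, PlaqSmallOn (plaqsInside (pts (k i) (Z i ∩ (Λ i)ᶜ))) (eR i) Vk →
      ∃ Ũ : VecField (F.P Kt) (k i) (EuclideanSpace ℂ (Fin 3)) × VecField (F.P Kt) (k i) (EuclideanSpace ℂ (Fin 3)) →
          PBond (F.P Kt) 0 → Matrix (Fin 2) (Fin 2) ℂ,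
        (∀ b a c, DifferentiableOn ℂ (fun z => Ũ z b a c) (ball 0 (R i))) ∧
        (∀ z ∈ ball (0 : VecField (F.P Kt) (k i) (EuclideanSpace ℂ (Fin 3)) × VecField (F.P Kt) (k i) (EuclideanSpace ℂ (Fin 3))) (R i),
          ∀ b a c, ‖Ũ z b a c‖ ≤ 𝓐₀ i) ∧
        ∀ p B' : VecField (F.P Kt) (k i) E3, ‖p‖ < R i → ‖B'‖ < R i → ∃ U' : GaugeField (F.P Kt) 0 SU2,
          (∀ b, Ũ (cplxVec p, cplxVec B') b = ((U' b : SU2) : Matrix (Fin 2) (Fin 2) ℂ)) ∧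
            IsMinimizer (Node00.avOfRecord F 2 Kt) (Node00.regMSCoPOfRecord F 2 ν Kt (k i) (maxDomT ν.M₁ (Z i))) (Bj ν.M₁ (Z i) (k i))
              (avgFamily (Node00.avOfRecord F 2 Kt) (qsstarGIter0 (k i) (expMul su2Chart B' (ext i (expMul su2Chart p Vk))))) U')
    -- (L2) (1.7)–(1.9) p.358 for the Hessian of the slice function at `0`
    (hlead : ∀ i Vk, PlaqSmallOn (plaqsInside (pts (k i) (Z i ∩ (Λ i)ᶜ))) (eR i) Vk →
      ∀ X : GaugeSlice (pts (k i) (Λ i)) (T i) E3,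
      |⟪X, (fderiv ℝ (rGrad (pts (k i) (Λ i)) (T i)
              (sliceFn (pts (k i) (Λ i)) (T i)
                (fun177std (Node00.bgMSCoPOfRecord F 2 ν Kt (k i) (maxDomT ν.M₁ (Z i))) ν.M₁ (Z i) (k i)) (ext i Vk))) 0) X⟫ -
          ∑ a : Fin 3, formDk (n' i) (fun _ : Fin (F.P Kt).d => (F.P Kt).sitesPerDir (k i))
            (ofRealCfg (fun _ : Fin (F.P Kt).d => (F.P Kt).sitesPerDir (k i)) fun j =>
              ιA (pts (k i) (Λ i)) (T i) X ⟨j.1, j.2⟩ a)| ≤ Cerr i * ‖X‖ ^ 2)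
    (hsm : ∀ i, Cerr i ≤ (4 / Real.pi ^ 2) ^ ((F.P Kt).d + 2) / (2 * (3 * (K i : ℝ) ^ 2 + 2 * (K i : ℝ) ^ 4)))
    (hγle : ∀ i, γ / (M i) ^ 5 ≤ (4 / Real.pi ^ 2) ^ ((F.P Kt).d + 2) / (2 * (3 * (K i : ℝ) ^ 2 + 2 * (K i : ℝ) ^ 4)))
    -- the geometric letter: the k-blocks over the bonds meeting `Λ^{(k)}` lie inside `Ω₁(Z)`
    (hfar : ∀ i (b : PBond (F.P Kt) 0), b.src ∉ maxDomT ν.M₁ (Z i) 1 →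
      (⟨blockIter (k i) b.src, b.dir⟩ : PBond (F.P Kt) (k i)) ∉ bondsOf (pts (k i) (Λ i)))
    -- (Gᵃ) geometry of `Z`: a union of `k`-blocks
    (hZblk : ∀ i, IsBlockUnion (k i) (Z i))
    -- print's `M₁ ≥ 2` and the torus divisibility `L^{k}M₁ ∣ 2L^{m+K}`
    (hM2 : 2 ≤ ν.M₁) (hdiv : ∀ i, side (F.P Kt).L ν.M₁ (k i) ∣ (F.P Kt).sitesPerDir 0)
    -- bookkeeping constants
    {cE B₃ a₀ a₁' cA : ℝ} (hcE0 : 0 ≤ cE) (hcE : ∀ i, 12 * ((F.P Kt).d : ℝ) * ((n i : ℝ) + 2) ^ 2 ≤ cE) (hB₃ : 0 ≤ B₃)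
    (heRa : ∀ i, (cE + 1) * eR i ≤ a₁' ∧ B₃ * ((cE + 1) * eR i) ≤ ν.εreg) (ha₀ : ν.εreg ≤ a₀)
    (hcA : 1 / 2 * (B₃ * (cE + 1) * (F.P Kt).eta 1 ^ 2) ^ 2 * (Fintype.card (Plaq (F.P Kt) 0) : ℝ) ≤ cA)
    -- [15] THEOREM 1 (R), CLOSED GENERAL-SEQUENCE FORM, GUARDED, IN NODE 00's TORUS-NATIVE CLASS (shape (C)) — served by K0⁷'s def (n12-d 12Q⁵)
    (h15T : ∀ (k' : ℕ), k' ≤ (F.P Kt).m + (F.P Kt).K → side (F.P Kt).L ν.M₁ k' ∣ (F.P Kt).sitesPerDir 0 →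
      ∀ (s : B14.Eq218Concrete.Seq (fun n : ℕ => Node00.unionsOfCubes (F.P Kt) (side (F.P Kt).L ν.M₁ n)) k'),
      Node00.Sect2.SeqSeparated ν.M₁ s → 0 < ν.M₁ →
      ∀ (ε₀ : ℝ) (δ : ℕ → ℝ), (∀ j, j ≤ k' → 0 < δ j ∧ δ j ≤ a₁' ∧ B₃ * δ j ≤ ε₀) → (∀ j, j < k' → δ j ≤ 2 * δ (j + 1)) →
      (∀ j, j < k' → δ (j + 1) ≤ 2 * δ j) → ε₀ ≤ a₀ →
      ∀ W : MSField (F.P Kt) SU2,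
        Node00.Sect2.DataSmall7PTop (Node00.avOfRecord F 2 Kt) s.Ω (Node00.suppDomOfRecord F ν Kt s.Ω) k' δ W →
        ∀ U₀ : GaugeField (F.P Kt) 0 SU2, IsMinimizer (Node00.avOfRecord F 2 Kt)
            {U | (∀ j, j ≤ k' → PlaqSmallOn (Node00.Sect2.omegaPlaqsTop s.Ω (Node00.suppDomOfRecord F ν Kt s.Ω) j)
                (ε₀ * (F.P Kt).eta j ^ 2) U) ∧
              Node00.Sect2.CoDivClassOnTop s.Ω (Node00.suppDomOfRecord F ν Kt s.Ω) k' ε₀ U}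
            (genSet s.Ω k') W U₀ →
          (∀ j, j ≤ k' → PlaqSmallOn (Node00.Sect2.omegaPlaqsTop s.Ω (Node00.suppDomOfRecord F ν Kt s.Ω) j)
              (B₃ * δ j * (F.P Kt).eta j ^ 2) U₀) ∧
            ∀ j, j ≤ k' → Node00.Sect2.CoDivSmallOn (Node00.Sect2.omegaBondsTop s.Ω (Node00.suppDomOfRecord F ν Kt s.Ω) j)
              (B₃ * δ j * (F.P Kt).eta j ^ 3) U₀)
    (hcJ' : ∀ i, 2 * cA * eR i / R i + 4 * ((Fintype.card (Plaq (F.P Kt) 0) : ℝ) * (1 + 8 * 𝓐₀ i ^ 4)) / (R i * eR i) ≤ cJ)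
    : ∃ a₁ : ι → ℝ, (∀ i, 0 < a₁ i) ∧
      B15.Prop1Printed (lfVarOn su2Chart fun i =>
        InstOn.std (Node00.bgMSCoPOfRecord F 2 ν Kt (k i) (maxDomT ν.M₁ (Z i))) ν.M₁ (Z i) (Λ i) (k i) (M i) (a₁ i)
          (anExt (pts (k i) (Λ i)) (T i)
            (fun177std (Node00.bgMSCoPOfRecord F 2 ν Kt (k i) (maxDomT ν.M₁ (Z i))) ν.M₁ (Z i) (k i)) (ext i)
            (min (1 / 2) (min (R i / 8) (γ / (M i) ^ 5 * (R i / 2) ^ 2 /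
              (48 * (4 * ((Fintype.card (Plaq (F.P Kt) 0) : ℝ) * (1 + 8 * 𝓐₀ i ^ 4)) / R i + 1))))))) :=
  exists_domain_prop1Printed_lfVarOn_std_su2_box_intrinsic_analytic_atZSeqCoPRecord_ofThm1TorusClass_ofValueMatched ν Kt hd3 h0 hcl Z Λ k M hk0 hk eR heR
    T lo hi n hn hN hbox hZ hTG0 hN5 K hK1 hKn ext hext hlohi hγ hcJ hbx hbxM hM hR n' hn'
    (fun i Vk hV => by
      obtain ⟨Ũ, hdiff, hbd, hreal⟩ := hMin i Vk hV
      refine ⟨Ũ, hdiff, hbd, fun p B' hp hB' => ?_⟩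
      obtain ⟨U', hU', hmin⟩ := hreal p B' hp hB'
      exact ⟨U', hU', (fun177std_bgMSCoPOfRecord_eq_wilsonAction4_of_isMinimizer (N := 2) ν Kt (k i) (maxDomT ν.M₁ (Z i)) ν.M₁ (Z i) (k i) hmin).symm⟩)
    hlead hsm hγle hfar hZblk hM2 hdiv hcE0 hcE hB₃ heRa ha₀ hcA h15T hcJ'

end Endpoint

end Literature.MathematicalPhysics.QuantumFieldTheory.Balaban1983to89.B15Prop1JointHolomorphyFromMinimiserFamily

end
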